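import Literature.Probability.LatticeModels.RandomCluster
import Literature.Probability.Percolation.BlockExploration
import HarnessLib

/-!
# Scale frames: nested annuli of a finite graph read through a radius function (definitions)

Topic `Literature/Probability/LatticeModels`. The bookkeeping vocabulary of multi-scale arguments for
dependent percolation on an ARBITRARY finite graph (H. Kesten, PTRF 73 (1986) §2; D. Basu,
A. Sapozhnikov, ECP 22 (2017) §2), abstracted from the lattice: a `ScaleFrame` is a finite edge set
`E` on a vertex type `V` together with a real "radius" `rad` (in the application: the chordal-chart
radius `‖φ⁻¹(δ v)‖` of a mesh site near a boundary prime end), a set `good` of vertices where the radius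
is meaningful, and a continuity modulus `η`: an edge of `E` at a good vertex of radius `< Rmax` leads to
a good vertex whose radius differs by less than `η` (for a conformal chart this holds once the mesh is
small, by uniform continuity of the chart on the closed domain). From these:

* regions `inSet s` (good, radius `≤ s`), `annSet s s'` (good, radius in `(s, s')`), `outSet s s'`
  (the rest), edge sets `edgesTouching A`, `edgesWithin A`;
* events `radCross s s'` (an open walk of `⟨E⟩` from `inSet s` to `outSet s s'` through `annSet s s'` —
  an open RADIAL CROSSING of the annulus) and `sepEvent s s'` (an open SEPARATOR: a vertex set of the
  annulus, pairwise joined by open paths inside the annulus, met by every walk of `⟨E⟩` from `inSet s`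
  to `outSet s s'`);
* the three RSW-type hypotheses of Kesten's scheme as predicates on a frame, each for the natural LOCAL
  random-cluster measure of the annulus: `SepBound` (separator likely under the FREE local measure),
  `NoCrossBound` (radial crossing unlikely under the local measure with everything off the annulus
  WIRED), `RadialBound` (radial crossing likely under the free local measure of the FATTENED annulus
  `(s/2, 2s')`).

Only definitions and their unfoldings; nothing is asserted. The point of the abstraction: the
probabilistic core of Kesten's ratio-limit theorem (Markov decoupling at explored sets, boundary
pushing, quasi-multiplicativity, Hopf contraction) never uses planarity or the lattice, only these data.

## References
* [Kesten1986] H. Kesten, Probab. Theory Related Fields 73 (1986) 369–394, §2.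
* [BasuSapozhnikov2017ECP] D. Basu, A. Sapozhnikov, ECP 22 (2017) no. 26, §2.
-/

noncomputable section

open scoped Classical
open Finset SimpleGraph
open Literature.Probability.Percolation (BondConfig openConnIn)

namespace Literature.Probability.LatticeModels

variable {V : Type*} [Fintype V] [DecidableEq V]

/-- **Scale frame**: a finite edge set with a radius function, the set of vertices where the radius is
meaningful, a continuity modulus `η` and a ceiling `Rmax`: along an edge from a good vertex of radius
`< Rmax` one reaches a good vertex and the radius changes by less than `η`.
[cite: Kesten1986, §2 (the annuli A_i and their separation)] -/
structure ScaleFrame (V : Type*) [Fintype V] [DecidableEq V] where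
  /-- the edges of the graph (`⟨E⟩ = fromEdgeSet E`) -/
  E : Finset (Sym2 V)
  /-- the radius of a vertex (meaningful on `good`) -/
  rad : V → ℝ
  /-- the vertices where the radius is read -/
  good : Set V
  /-- continuity modulus of the radius along edges -/
  η : ℝ
  /-- ceiling below which the frame is used -/
  Rmax : ℝ
  η_pos : 0 < η
  /-- an edge at a good vertex of radius `< Rmax` ends at a good vertex of nearby radius -/
  adj_good : ∀ e ∈ E, ∀ u ∈ e, ∀ v ∈ e, u ∈ good → rad u < Rmax → v ∈ good ∧ |rad v - rad u| < η

namespace ScaleFrame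

variable (F : ScaleFrame V)

/-- The graph of the frame. [cite: Kesten1986, §2] -/
def graph : SimpleGraph V := fromEdgeSet (F.E : Set (Sym2 V))

/-- The inside of scale `s`: good vertices of radius `≤ s`. [cite: Kesten1986, §2 (S(3^k))] -/
def inSet (s : ℝ) : Set V := {v | v ∈ F.good ∧ F.rad v ≤ s}

/-- The annulus of scales `(s, s')`: good vertices of radius in `(s, s')`. [cite: Kesten1986, §2 (A_i)] -/
def annSet (s s' : ℝ) : Set V := {v | v ∈ F.good ∧ s < F.rad v ∧ F.rad v < s'}

/-- The outside of the annulus `(s, s')`: everything not inside and not in the annulus.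
[cite: Kesten1986, §2] -/
def outSet (s s' : ℝ) : Set V := (F.inSet s ∪ F.annSet s s')ᶜ

/-- The edges of the frame touching a vertex set. [cite: BasuSapozhnikov2017ECP, §2] -/
def edgesTouching (A : Set V) : Finset (Sym2 V) :=
  F.E.filter fun e => ∃ v ∈ e, v ∈ A

/-- The edges of the frame with both endpoints in a vertex set. [cite: BasuSapozhnikov2017ECP, §2] -/
def edgesWithin (A : Set V) : Finset (Sym2 V) :=
  F.E.filter fun e => ∀ v ∈ e, v ∈ A

/-- **Open radial crossing** of the annulus `(s, s')`: an open walk of `⟨E⟩` from the inside to the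
outside, all of whose other vertices lie in the annulus. [cite: Kesten1986, §2 (eq. (28), crossings of annuli)] -/
def radCross (s s' : ℝ) : Set (BondConfig V) :=
  {ω | ∃ (a b : V) (w : F.graph.Walk a b), a ∈ F.inSet s ∧ b ∈ F.outSet s s' ∧
    (∀ z ∈ w.support, z = a ∨ z = b ∨ z ∈ F.annSet s s') ∧ ∀ e ∈ w.edges, e ∈ ω}

/-- **Open separator** of the annulus `(s, s')`: a vertex set of the annulus, pairwise joined by open
paths inside the annulus, meeting every walk of `⟨E⟩` from the inside to the outside ("an open circuit
in the annulus", planarity-free). [cite: Kesten1986, §2 (occupied circuits surrounding S(3^k))] -/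
def sepEvent (s s' : ℝ) : Set (BondConfig V) :=
  {ω | ∃ P : Set V, P ⊆ F.annSet s s' ∧ (∀ a ∈ P, ∀ b ∈ P, ω ∈ openConnIn (F.annSet s s') a b) ∧
    ∀ (a b : V), a ∈ F.inSet s → b ∈ F.outSet s s' →
      ∀ w : F.graph.Walk a b, ∃ z ∈ w.support, z ∈ P}

/-- **RSW (i): separators are likely under the free local measure of the annulus** (with constant `c`,
parameters `p, q`). [cite: Kesten1986, §2 eq. (28)] -/
def SepBound (p q c s s' : ℝ) : Prop :=
  c ≤ (rcMeasure (fromEdgeSet (↑(F.edgesTouching (F.annSet s s')) : Set (Sym2 V))) p q ∅).real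
    (F.sepEvent s s')

/-- **RSW (ii): radial crossings are unlikely under the local measure of the annulus with everything
off the annulus wired** (constant `c`). [cite: Kesten1986, §2 (dual form of eq. (28))] -/
def NoCrossBound (p q c s s' : ℝ) : Prop :=
  (rcMeasure (fromEdgeSet (↑(F.edgesTouching (F.annSet s s')) : Set (Sym2 V))) p q
    (F.annSet s s')ᶜ).real (F.radCross s s') ≤ 1 - c

/-- **RSW (iii): radial crossings are likely under the free local measure of the fattened annulus
`(s/2, 2s')`** (constant `c`). [cite: Kesten1986, §2 eqs. (26)–(27)] -/
def RadialBound (p q c s s' : ℝ) : Prop :=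
  c ≤ (rcMeasure (fromEdgeSet (↑(F.edgesTouching (F.annSet (s / 2) (2 * s'))) : Set (Sym2 V))) p q ∅).real
    (F.radCross s s')

/-! ### Unfoldings -/

/-- Membership in `inSet`. [cite: Kesten1986, §2] -/
@[simp] theorem mem_inSet {s : ℝ} {v : V} : v ∈ F.inSet s ↔ v ∈ F.good ∧ F.rad v ≤ s := Iff.rfl

/-- Membership in `annSet`. [cite: Kesten1986, §2] -/
@[simp] theorem mem_annSet {s s' : ℝ} {v : V} :
    v ∈ F.annSet s s' ↔ v ∈ F.good ∧ s < F.rad v ∧ F.rad v < s' := Iff.rfl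

/-- Membership in `outSet`. [cite: Kesten1986, §2] -/
theorem mem_outSet {s s' : ℝ} {v : V} : v ∈ F.outSet s s' ↔ v ∉ F.inSet s ∪ F.annSet s s' := Iff.rfl

/-- Membership in `edgesTouching`. [cite: BasuSapozhnikov2017ECP, §2] -/
@[simp] theorem mem_edgesTouching {A : Set V} {e : Sym2 V} :
    e ∈ F.edgesTouching A ↔ e ∈ F.E ∧ ∃ v ∈ e, v ∈ A := by
  simp [edgesTouching]

/-- Membership in `edgesWithin`. [cite: BasuSapozhnikov2017ECP, §2] -/
@[simp] theorem mem_edgesWithin {A : Set V} {e : Sym2 V} :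
    e ∈ F.edgesWithin A ↔ e ∈ F.E ∧ ∀ v ∈ e, v ∈ A := by
  simp [edgesWithin]

/-- The three regions of a scale pair are pairwise disjoint: inside vs annulus. [cite: Kesten1986, §2] -/
theorem inSet_disjoint_annSet (s s' : ℝ) : Disjoint (F.inSet s) (F.annSet s s') := by
  rw [Set.disjoint_left]
  rintro v ⟨-, hv⟩ ⟨-, hv', -⟩
  exact absurd hv (not_le.2 hv')

/-- **No edge jumps an annulus wider than the modulus**: an edge at a vertex of the inside of scale `s`
(with `s + η ≤ s'`, `s' ≤ Rmax`) ends inside or in the annulus `(s, s')`. [cite: Kesten1986, §2] -/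
theorem mem_inSet_or_annSet_of_adj {s s' : ℝ} (hss : s + F.η ≤ s') (hs' : s' ≤ F.Rmax)
    {e : Sym2 V} (he : e ∈ F.E) {u v : V} (hu : u ∈ e) (hv : v ∈ e) (hu' : u ∈ F.inSet s) :
    v ∈ F.inSet s ∨ v ∈ F.annSet s s' := by
  obtain ⟨hug, hur⟩ := hu'
  have hR : F.rad u < F.Rmax := by linarith [F.η_pos]
  obtain ⟨hvg, hvr⟩ := F.adj_good e he u hu v hv hug hR
  by_cases h : F.rad v ≤ s
  · exact Or.inl ⟨hvg, h⟩
  · refine Or.inr ⟨hvg, not_le.1 h, ?_⟩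
    have := (abs_lt.1 hvr).2
    linarith

end ScaleFrame

/-! ### The RSW ladder (appended 2026-08-16, lead c3) -/

namespace ScaleFrame

variable (F : ScaleFrame V)

/-- **RSW ladder** on the geometric scales `a, aM, …, aM^n` with one constant `c`: separators and
no-crossing bounds for every CONSECUTIVE annulus `(aM^i, aM^{i+1})`, `i < n`, and the radial-crossing
bound for EVERY annulus `(aM^i, aM^j)`, `i < j ≤ n` (all moduli `M^{j-i}` at once — a radial crossing
of a long annulus is not glued from short ones). In the application the three come from boundary RSW
(CDH16) and bulk RSW (DHN11) with `c` the minimum of finitely many constants.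
[cite: Kesten1986, §2 eqs. (26)–(28)] -/
def LadderRSW (p q c a M : ℝ) (n : ℕ) : Prop :=
  ∀ i j : ℕ, i < j → j ≤ n →
    F.SepBound p q c (a * M ^ i) (a * M ^ (i + 1)) ∧ F.NoCrossBound p q c (a * M ^ i) (a * M ^ (i + 1)) ∧
      F.RadialBound p q c (a * M ^ i) (a * M ^ j)

/-- `LadderRSW`, unfolded. [cite: Kesten1986, §2] -/
theorem ladderRSW_iff {p q c a M : ℝ} {n : ℕ} :
    F.LadderRSW p q c a M n ↔ ∀ i j : ℕ, i < j → j ≤ n →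
      F.SepBound p q c (a * M ^ i) (a * M ^ (i + 1)) ∧ F.NoCrossBound p q c (a * M ^ i) (a * M ^ (i + 1)) ∧
        F.RadialBound p q c (a * M ^ i) (a * M ^ j) :=
  Iff.rfl

/-- A ladder restricts to fewer scales. [cite: Kesten1986, §2] -/
theorem LadderRSW.mono {p q c a M : ℝ} {n m : ℕ} (h : F.LadderRSW p q c a M n) (hmn : m ≤ n) :
    F.LadderRSW p q c a M m :=
  fun i j hij hj => h i j hij (hj.trans hmn)

/-- A ladder shifts: the scales `aM^k, …` form a ladder with base `aM^k`. [cite: Kesten1986, §2] -/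
theorem LadderRSW.shift {p q c a M : ℝ} {n : ℕ} (h : F.LadderRSW p q c a M n) (k : ℕ) (hk : k ≤ n) :
    F.LadderRSW p q c (a * M ^ k) M (n - k) := by
  intro i j hij hj
  have h1 : ∀ t : ℕ, a * M ^ k * M ^ t = a * M ^ (k + t) := fun t => by rw [pow_add, mul_assoc]
  rw [h1, h1, h1, show k + (i + 1) = (k + i) + 1 by ring]
  exact h (k + i) (k + j) (by omega) (by omega)

end ScaleFrame

/-! ### The RSW ladder with bounded radial span (appended 2026-08-16, lead c3)

`LadderRSW` asks the radial-crossing bound for EVERY pair of scales of the ladder, so its constant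
degrades with the length of the ladder; Kesten's scheme only ever glues across a BOUNDED number of
consecutive annuli (twelve, in the quasi-multiplicativity step), while the length of the ladder is
chosen afterwards from that very constant. The bounded-span ladder below breaks this circularity. -/

namespace ScaleFrame

variable (F : ScaleFrame V)

/-- **RSW ladder with radial span `b`**: separator and no-crossing bounds for every consecutive annulus
`(aM^i, aM^{i+1})`, `i < n`, and the radial-crossing bound for the annuli `(aM^i, aM^j)` with
`i < j ≤ min n (i + b)` only. [cite: Kesten1986, §2 eqs. (26)–(28)] -/
def LadderRSWb (p q c a M : ℝ) (n b : ℕ) : Prop :=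
  ∀ i j : ℕ, i < j → j ≤ n → j ≤ i + b →
    F.SepBound p q c (a * M ^ i) (a * M ^ (i + 1)) ∧ F.NoCrossBound p q c (a * M ^ i) (a * M ^ (i + 1)) ∧
      F.RadialBound p q c (a * M ^ i) (a * M ^ j)

/-- `LadderRSWb`, unfolded. [cite: Kesten1986, §2] -/
theorem ladderRSWb_iff {p q c a M : ℝ} {n b : ℕ} :
    F.LadderRSWb p q c a M n b ↔ ∀ i j : ℕ, i < j → j ≤ n → j ≤ i + b →
      F.SepBound p q c (a * M ^ i) (a * M ^ (i + 1)) ∧ F.NoCrossBound p q c (a * M ^ i) (a * M ^ (i + 1)) ∧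
        F.RadialBound p q c (a * M ^ i) (a * M ^ j) :=
  Iff.rfl

/-- The full ladder is a bounded-span ladder for every span. [cite: Kesten1986, §2] -/
theorem LadderRSW.ladderRSWb {p q c a M : ℝ} {n : ℕ} (h : F.LadderRSW p q c a M n) (b : ℕ) :
    F.LadderRSWb p q c a M n b :=
  fun i j hij hj _ => h i j hij hj

/-- A bounded-span ladder restricts to fewer scales. [cite: Kesten1986, §2] -/
theorem LadderRSWb.mono {p q c a M : ℝ} {n m b : ℕ} (h : F.LadderRSWb p q c a M n b) (hmn : m ≤ n) :
    F.LadderRSWb p q c a M m b :=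
  fun i j hij hj hb => h i j hij (hj.trans hmn) hb

/-- A bounded-span ladder shifts its base. [cite: Kesten1986, §2] -/
theorem LadderRSWb.shift {p q c a M : ℝ} {n b : ℕ} (h : F.LadderRSWb p q c a M n b) (k : ℕ) (hk : k ≤ n) :
    F.LadderRSWb p q c (a * M ^ k) M (n - k) b := by
  intro i j hij hj hb
  have h1 : ∀ t : ℕ, a * M ^ k * M ^ t = a * M ^ (k + t) := fun t => by rw [pow_add, mul_assoc]
  rw [h1, h1, h1, show k + (i + 1) = (k + i) + 1 by ring]
  exact h (k + i) (k + j) (by omega) (by omega) (by omega)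

/-- Consecutive-annulus bounds from a bounded-span ladder (span `≥ 1`). [cite: Kesten1986, §2] -/
theorem LadderRSWb.sepBound {p q c a M : ℝ} {n b : ℕ} (h : F.LadderRSWb p q c a M n b) (hb : 1 ≤ b)
    {i : ℕ} (hi : i + 1 ≤ n) : F.SepBound p q c (a * M ^ i) (a * M ^ (i + 1)) :=
  (h i (i + 1) (Nat.lt_succ_self i) hi (by omega)).1

/-- Consecutive-annulus no-crossing bounds from a bounded-span ladder (span `≥ 1`). [cite: Kesten1986, §2] -/
theorem LadderRSWb.noCrossBound {p q c a M : ℝ} {n b : ℕ} (h : F.LadderRSWb p q c a M n b) (hb : 1 ≤ b)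
    {i : ℕ} (hi : i + 1 ≤ n) : F.NoCrossBound p q c (a * M ^ i) (a * M ^ (i + 1)) :=
  (h i (i + 1) (Nat.lt_succ_self i) hi (by omega)).2.1

/-- Radial bounds within the span. [cite: Kesten1986, §2] -/
theorem LadderRSWb.radialBound {p q c a M : ℝ} {n b : ℕ} (h : F.LadderRSWb p q c a M n b)
    {i j : ℕ} (hij : i < j) (hj : j ≤ n) (hb : j ≤ i + b) : F.RadialBound p q c (a * M ^ i) (a * M ^ j) :=
  (h i j hij hj hb).2.2

end ScaleFrame

end Literature.Probability.LatticeModels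

end
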